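import Literature.MathematicalPhysics.QuantumLattice.GrassmannGaussianSourceDerivative
import HarnessLib

/-!
# Stub `stub_grassmannGaussian_source_deriv` of line `pin-the-infimum` (crux `RobustYangMillsHandover`, item 8892)

E2-a of the Lüscher dictionary infrastructure (fermionic insertions in the transfer-matrix representation
of the QCD torus functional): the SOURCE TRICK for bilinear insertions in Gaussian Berezin functionals.
For every `ℂ`-linear functional `φ` on the complex-fermion Grassmann algebra on `ι ⊕ₗ ι` (e.g. the Berezin
integral `∫dψ̄dψ`, or `y ↦ ∫ X' y`), every element `X` and all matrices `A` (action) and `J` (source), the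
real function `s ↦ φ (X e^{ψ̄(A + sJ)ψ})` is differentiable at `0` with derivative `φ (X · ψ̄Jψ · e^{ψ̄Aψ})`
— inserting the bilinear `ψ̄Jψ = quadratic ℂ J` equals differentiating in the source strength.  It is the
`𝕜 = ℂ`, real-parameter instance of
`Literature.MathematicalPhysics.QuantumLattice.hasDerivAt_apply_mul_grassmannExp_quadratic_add_ofReal_smul_zero`
(`Literature/MathematicalPhysics/QuantumLattice/GrassmannGaussianSourceDerivative.lean`: `ψ̄Jψ` is central
and nilpotent, so `e^{ψ̄(A+sJ)ψ} = e^{ψ̄Aψ} Σ_{i<K} sⁱ(ψ̄Jψ)ⁱ/i!` and `s ↦ φ(X e^{ψ̄(A+sJ)ψ})` is a complex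
polynomial in `s` whose linear coefficient is `φ(X e^{ψ̄Aψ} ψ̄Jψ) = φ(X ψ̄Jψ e^{ψ̄Aψ})`).
-/

open Literature.MathematicalPhysics.QuantumLattice

namespace Summit.QuantumFields.QCD.Cruxes.RobustYangMillsHandover.PinTheInfimum

/-- **E2-a: source derivative of a Gaussian Berezin functional** — the bilinear insertion `ψ̄Jψ` is
`d/ds|₀` of the source-shifted Gaussian: for every linear functional `φ` on the complex-fermion Grassmann
algebra, every `X` and all complex matrices `A`, `J`,
`HasDerivAt (s ↦ φ (X e^{ψ̄(A + sJ)ψ})) (φ (X ψ̄Jψ e^{ψ̄Aψ})) 0` (real source strength `s`;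
`Literature.MathematicalPhysics.QuantumLattice.hasDerivAt_apply_mul_grassmannExp_quadratic_add_ofReal_smul_zero`;
Berezin 1966, Ch. I §3; Montvay–Münster 1994, §4.1).  The statement is the registered stub signature
verbatim. -/
theorem stub_grassmannGaussian_source_deriv :
    ∀ (ι : Type) [LinearOrder ι] [Fintype ι] (φ : GrassmannAlgebra ℂ (ι ⊕ₗ ι) →ₗ[ℂ] ℂ) (A J : Matrix ι ι ℂ)
      (X : GrassmannAlgebra ℂ (ι ⊕ₗ ι)),
      HasDerivAt (fun s : ℝ => φ (X * grassmannExp (quadratic ℂ (A + (s : ℂ) • J))))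
        (φ (X * quadratic ℂ J * grassmannExp (quadratic ℂ A))) 0 :=
  fun _ _ _ φ A J X => hasDerivAt_apply_mul_grassmannExp_quadratic_add_ofReal_smul_zero φ A J X

end Summit.QuantumFields.QCD.Cruxes.RobustYangMillsHandover.PinTheInfimum
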